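import Literature.Algebra.EuclideanLattices.UniqueSVPMultiples
import HarnessLib

/-!
# Regev 2004, Claim 3.13 (and 3.5): the measured register holds at most one pair, with the hidden difference

Topic `Algebra/EuclideanLattices` (family `pqc`). Proved material (no named fact) towards the named
fact `Literature.Algebra.EuclideanLattices.usvp_of_dihedralCoset` (O. Regev, *Quantum computation
and lattice problems*, SIAM J. Comput. 33 (2004), Thm. 1.1), assembling the two ingredients of
`UniqueSVPMultiples.lean` into the claim as printed (p. 14, Claim 3.13; the cube version Claim 3.5,
p. 8, is the same statement with another cell `D`):

> For every `x̄'`, there is at most one element of the form `(0, ā)` and at most one element of the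
> form `(1, ā')` such that `x̄' ∈ f(t, ā) + D`. Moreover, if there are two such elements `(0, ā)` and
> `(1, ā')` then `ā' − ā` is the vector `((u₁ − m)/p, u₂, …, uₙ)`.

Here `f(t, ā) = (a_{i₀} p + t m) b_{i₀} + ∑_{i ≠ i₀} aᵢ bᵢ` is Regev's map (`regevPoint`; the paper takes
`i₀ = 1`), `ū = ∑ uᵢ bᵢ` is a shortest nonzero vector of the lattice `L ∋ bᵢ`, `p` is a prime with
`p ∤ m` and `u_{i₀} ≡ m (mod p)`, and `D` is any set of diameter `≤ 2T` (Regev: the grid points of a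
ball of radius `T = R`, resp. of a cube) with `2T < λ₂(L)` (the unique-SVP gap: "for `c_unq > 2c_bal`
this means `v̄' − v̄ = k ū`") and `2T < (p − 1)‖ū‖` (so that `|k| < p − 1`; Regev: `p > n^{2+2f}`).

* `Regev2004.exists_int_of_mem_regevPoint_add` — the core: two representations
  `x' ∈ f(t,ā) + D`, `x' ∈ f(t',ā') + D` force `f(t',ā') − f(t,ā) = k ū` with `k ≡ t' − t (mod p)`
  and `|k| < p − 1`, coefficientwise;
* `Regev2004.eq_of_mem_regevPoint_add` — same `t`: `ā = ā'` ("at most one element");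
* `Regev2004.sub_eq_of_mem_regevPoint_add` — `t = 0`, `t' = 1`: `p ∣ u_{i₀} − m` and
  `ā' − ā = (…, (u_{i₀} − m)/p, …, uᵢ, …)`.

## References

* O. Regev, *Quantum computation and lattice problems*, SIAM J. Comput. 33 (2004) 738–760,
  Claim 3.13 and its proof (pp. 14–15), Claim 3.5 (pp. 8–9) [Regev2004].
-/

noncomputable section

open Module Metric

namespace Literature.Algebra.EuclideanLattices

variable {E : Type*} [NormedAddCommGroup E] [NormedSpace ℝ E] {n : ℕ}

/-- **Regev's map** `f(t, ā) = (a_{i₀} p + t m) b_{i₀} + ∑_{i ≠ i₀} aᵢ bᵢ` (p. 8 with `i₀ = 1`: the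
lattice point with coefficient vector `ā` except `a_{i₀} p + t m` at `i₀`).
[cite: Regev2004, Lemma 3.4 (proof, p. 8) and Lemma 3.12 (proof, p. 14)] -/
def regevPoint (b : Fin n → E) (p : ℕ) (m : ℤ) (i₀ : Fin n) (t : ℤ) (a : Fin n → ℤ) : E :=
  ∑ i, ((Function.update a i₀ (a i₀ * p + t * m) i : ℤ) : ℝ) • b i

/-- Regev's map takes values in any `ℤ`-submodule containing the `bᵢ`. [folklore] -/
theorem regevPoint_mem {L : Submodule ℤ E} {b : Fin n → E} (hbL : ∀ i, b i ∈ L) (p : ℕ) (m : ℤ)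
    (i₀ : Fin n) (t : ℤ) (a : Fin n → ℤ) : regevPoint b p m i₀ t a ∈ L := by
  unfold regevPoint
  refine L.sum_mem fun i _ => ?_
  rw [Int.cast_smul_eq_zsmul]
  exact L.smul_mem _ (hbL i)

/-- An integer combination of the `bᵢ` lies in any `ℤ`-submodule containing them. [folklore] -/
theorem sum_intCast_smul_mem {L : Submodule ℤ E} {b : Fin n → E} (hbL : ∀ i, b i ∈ L)
    (u : Fin n → ℤ) : ∑ i, ((u i : ℤ) : ℝ) • b i ∈ L := by
  refine L.sum_mem fun i _ => ?_
  rw [Int.cast_smul_eq_zsmul]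
  exact L.smul_mem _ (hbL i)

/-- Coefficient comparison in an `ℝ`-linearly independent family: if
`∑ c'ᵢ bᵢ − ∑ cᵢ bᵢ = k ∑ uᵢ bᵢ` with integer coefficients then `c'ᵢ − cᵢ = k uᵢ` for every `i`.
[folklore] -/
theorem intCoeff_sub_eq_of_sum_sub_eq_smul {b : Fin n → E} (hb : LinearIndependent ℝ b)
    {c c' u : Fin n → ℤ} {k : ℤ}
    (h : ∑ i, ((c' i : ℤ) : ℝ) • b i - ∑ i, ((c i : ℤ) : ℝ) • b i =
      (k : ℝ) • ∑ i, ((u i : ℤ) : ℝ) • b i) (i : Fin n) :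
    c' i - c i = k * u i := by
  have hzero : ∑ j, ((c' j - c j - k * u j : ℤ) : ℝ) • b j = 0 := by
    have : ∑ j, ((c' j - c j - k * u j : ℤ) : ℝ) • b j =
        (∑ j, ((c' j : ℤ) : ℝ) • b j - ∑ j, ((c j : ℤ) : ℝ) • b j) -
          (k : ℝ) • ∑ j, ((u j : ℤ) : ℝ) • b j := by
      simp only [Int.cast_sub, Int.cast_mul, sub_smul, mul_smul, Finset.sum_sub_distrib,
        Finset.smul_sum]
    rw [this, h, sub_self]
  have hcoef := (Fintype.linearIndependent_iff.1 hb) _ hzero i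
  have hint : c' i - c i - k * u i = 0 := by exact_mod_cast hcoef
  linarith

/-- **Regev 2004, Claims 3.5 / 3.13 — the core.** Let `L` be a discrete `ℤ`-submodule of a real
normed space (real span of dimension `≥ 2`) containing the `ℝ`-independent vectors `bᵢ`, let
`ū = ∑ uᵢ bᵢ ≠ 0` have `‖ū‖ = λ₁(L)`, let `p` be a prime with `p ∤ m` and `u_{i₀} ≡ m (mod p)`, and let
`D` have diameter `≤ 2T` where `2T < λ₂(L)` and `2T < (p − 1)‖ū‖`. If `x' ∈ f(t, ā) + D` and
`x' ∈ f(t', ā') + D`, then the coefficient vectors of `f(t', ā')` and `f(t, ā)` differ by `k ū` for an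
integer `k ≡ t' − t (mod p)` with `|k| < p − 1` ("`‖v̄ − v̄'‖ ≤ 2R` … `v̄' − v̄ = k ū` … `k ≡ t' − t`").
[cite: Regev2004, Claim 3.13 (proof, pp. 14–15)] -/
theorem Regev2004.exists_int_of_mem_regevPoint_add (L : Submodule ℤ E) [DiscreteTopology L]
    (h2 : 2 ≤ finrank ℝ (Submodule.span ℝ (L : Set E)))
    {b : Fin n → E} (hb : LinearIndependent ℝ b) (hbL : ∀ i, b i ∈ L)
    {u : Fin n → ℤ} (hu0 : ∑ i, ((u i : ℤ) : ℝ) • b i ≠ 0)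
    (hmin : ‖∑ i, ((u i : ℤ) : ℝ) • b i‖ = minNorm L)
    {p : ℕ} (hp : p.Prime) {m : ℤ} (hm : ¬ (p : ℤ) ∣ m) {i₀ : Fin n} (hui : u i₀ ≡ m [ZMOD p])
    {T : ℝ} (hgap : 2 * T < successiveMinimum L 2)
    (hTp : 2 * T < ((p : ℝ) - 1) * ‖∑ i, ((u i : ℤ) : ℝ) • b i‖)
    {D : Set E} (hD : ∀ y ∈ D, ∀ y' ∈ D, ‖y - y'‖ ≤ 2 * T)
    {t t' : ℤ} {a a' : Fin n → ℤ} {x' : E}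
    (hx : ∃ y ∈ D, x' = regevPoint b p m i₀ t a + y)
    (hx' : ∃ y' ∈ D, x' = regevPoint b p m i₀ t' a' + y') :
    ∃ k : ℤ, (∀ i, Function.update a' i₀ (a' i₀ * p + t' * m) i -
        Function.update a i₀ (a i₀ * p + t * m) i = k * u i) ∧
      k ≡ t' - t [ZMOD p] ∧ |k| < p - 1 := by
  obtain ⟨y, hy, hxy⟩ := hx
  obtain ⟨y', hy', hxy'⟩ := hx'
  set uvec : E := ∑ i, ((u i : ℤ) : ℝ) • b i with huvec
  set v : E := regevPoint b p m i₀ t a with hv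
  set v' : E := regevPoint b p m i₀ t' a' with hv'
  -- `v' - v = y - y'` is a lattice vector of norm `≤ 2T < λ₂`
  have hdiff : v' - v = y - y' := by
    have : v + y = v' + y' := hxy.symm.trans hxy'
    rw [sub_eq_sub_iff_add_eq_add, ← this, add_comm]
  have hnorm : ‖v' - v‖ ≤ 2 * T := by rw [hdiff]; exact hD y hy y' hy'
  have hmem : v' - v ∈ L := L.sub_mem (regevPoint_mem hbL p m i₀ t' a') (regevPoint_mem hbL p m i₀ t a)
  have huL : uvec ∈ L := sum_intCast_smul_mem hbL u
  obtain ⟨k, hk⟩ := exists_int_smul_of_norm_lt_successiveMinimum_two L h2 huL hu0 hmin hmem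
    (hnorm.trans_lt hgap)
  -- coefficientwise, and `k ≡ t' - t (mod p)`
  have hk' : ∑ i, ((Function.update a' i₀ (a' i₀ * p + t' * m) i : ℤ) : ℝ) • b i -
      ∑ i, ((Function.update a i₀ (a i₀ * p + t * m) i : ℤ) : ℝ) • b i = (k : ℝ) • uvec := by
    rw [← Int.cast_smul_eq_zsmul ℝ k] at hk
    exact hk
  refine ⟨k, fun i => intCoeff_sub_eq_of_sum_sub_eq_smul hb hk' i,
    Regev2004.int_modEq_of_sub_eq_smul hb hp hm hui hk', ?_⟩
  -- `|k| ‖ū‖ = ‖v' - v‖ ≤ 2T < (p - 1) ‖ū‖`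
  have hupos : 0 < ‖uvec‖ := norm_pos_iff.2 hu0
  have hkn : |(k : ℝ)| * ‖uvec‖ ≤ 2 * T := by
    have : ‖v' - v‖ = |(k : ℝ)| * ‖uvec‖ := by
      rw [hk, ← Int.cast_smul_eq_zsmul ℝ k, norm_smul, Real.norm_eq_abs]
    rw [← this]
    exact hnorm
  have hlt : |(k : ℝ)| < (p : ℝ) - 1 := lt_of_mul_lt_mul_right (hkn.trans_lt hTp) hupos.le
  exact_mod_cast hlt

/-- **Claim 3.13, first part: at most one element with a given `t`.** Under the hypotheses of
`Regev2004.exists_int_of_mem_regevPoint_add`, if `x' ∈ f(t, ā) + D` and `x' ∈ f(t, ā') + D` then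
`ā = ā'` ("If `t = t'` then `k ≡ 0 (mod p)` … `|k| ≥ p` which contradicts the upper bound").
[cite: Regev2004, Claim 3.13 (proof, p. 15)] -/
theorem Regev2004.eq_of_mem_regevPoint_add (L : Submodule ℤ E) [DiscreteTopology L]
    (h2 : 2 ≤ finrank ℝ (Submodule.span ℝ (L : Set E)))
    {b : Fin n → E} (hb : LinearIndependent ℝ b) (hbL : ∀ i, b i ∈ L)
    {u : Fin n → ℤ} (hu0 : ∑ i, ((u i : ℤ) : ℝ) • b i ≠ 0)
    (hmin : ‖∑ i, ((u i : ℤ) : ℝ) • b i‖ = minNorm L)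
    {p : ℕ} (hp : p.Prime) {m : ℤ} (hm : ¬ (p : ℤ) ∣ m) {i₀ : Fin n} (hui : u i₀ ≡ m [ZMOD p])
    {T : ℝ} (hgap : 2 * T < successiveMinimum L 2)
    (hTp : 2 * T < ((p : ℝ) - 1) * ‖∑ i, ((u i : ℤ) : ℝ) • b i‖)
    {D : Set E} (hD : ∀ y ∈ D, ∀ y' ∈ D, ‖y - y'‖ ≤ 2 * T)
    {t : ℤ} {a a' : Fin n → ℤ} {x' : E}
    (hx : ∃ y ∈ D, x' = regevPoint b p m i₀ t a + y)
    (hx' : ∃ y' ∈ D, x' = regevPoint b p m i₀ t a' + y') : a = a' := by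
  obtain ⟨k, hcoef, hkmod, hkabs⟩ :=
    Regev2004.exists_int_of_mem_regevPoint_add L h2 hb hbL hu0 hmin hp hm hui hgap hTp hD hx hx'
  rw [sub_self] at hkmod
  have hk0 : k = 0 := Regev2004.eq_zero_of_modEq_zero_of_abs_lt hkmod (by linarith)
  have hp0 : (p : ℤ) ≠ 0 := by exact_mod_cast hp.ne_zero
  funext i
  have hi := hcoef i
  rw [hk0, zero_mul, sub_eq_zero] at hi
  by_cases hii : i = i₀
  · subst hii
    simp only [Function.update_self] at hi
    have : (a' i - a i) * p = 0 := by linarith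
    rcases mul_eq_zero.1 this with h | h
    · linarith
    · exact absurd h hp0
  · simp only [Function.update_of_ne hii] at hi
    exact hi.symm

/-- **Claim 3.13, second part: the hidden difference.** Under the same hypotheses, if
`x' ∈ f(0, ā) + D` and `x' ∈ f(1, ā') + D` then `p ∣ u_{i₀} − m` and
`ā' − ā = (u₀, …, (u_{i₀} − m)/p, …, u_{n−1})` ("`k ≡ 1 (mod p)` … this can only happen when `k = 1`").
[cite: Regev2004, Claim 3.13 (proof, p. 15)] -/
theorem Regev2004.sub_eq_of_mem_regevPoint_add (L : Submodule ℤ E) [DiscreteTopology L]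
    (h2 : 2 ≤ finrank ℝ (Submodule.span ℝ (L : Set E)))
    {b : Fin n → E} (hb : LinearIndependent ℝ b) (hbL : ∀ i, b i ∈ L)
    {u : Fin n → ℤ} (hu0 : ∑ i, ((u i : ℤ) : ℝ) • b i ≠ 0)
    (hmin : ‖∑ i, ((u i : ℤ) : ℝ) • b i‖ = minNorm L)
    {p : ℕ} (hp : p.Prime) {m : ℤ} (hm : ¬ (p : ℤ) ∣ m) {i₀ : Fin n} (hui : u i₀ ≡ m [ZMOD p])
    {T : ℝ} (hgap : 2 * T < successiveMinimum L 2)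
    (hTp : 2 * T < ((p : ℝ) - 1) * ‖∑ i, ((u i : ℤ) : ℝ) • b i‖)
    {D : Set E} (hD : ∀ y ∈ D, ∀ y' ∈ D, ‖y - y'‖ ≤ 2 * T)
    {a a' : Fin n → ℤ} {x' : E}
    (hx : ∃ y ∈ D, x' = regevPoint b p m i₀ 0 a + y)
    (hx' : ∃ y' ∈ D, x' = regevPoint b p m i₀ 1 a' + y') :
    (p : ℤ) ∣ u i₀ - m ∧
      ∀ i, a' i - a i = if i = i₀ then (u i₀ - m) / p else u i := by
  obtain ⟨k, hcoef, hkmod, hkabs⟩ :=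
    Regev2004.exists_int_of_mem_regevPoint_add L h2 hb hbL hu0 hmin hp hm hui hgap hTp hD hx hx'
  rw [sub_zero] at hkmod
  have hk1 : k = 1 := Regev2004.eq_one_of_modEq_one_of_abs_lt hkmod hkabs
  have hp0 : (p : ℤ) ≠ 0 := by exact_mod_cast hp.ne_zero
  have hi₀ := hcoef i₀
  simp only [Function.update_self, hk1, one_mul, zero_mul, add_zero] at hi₀
  -- `hi₀ : a' i₀ * p + m - a i₀ * p = u i₀`
  have hdvd : (p : ℤ) ∣ u i₀ - m := ⟨a' i₀ - a i₀, by linarith⟩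
  refine ⟨hdvd, fun i => ?_⟩
  by_cases hii : i = i₀
  · subst hii
    rw [if_pos rfl]
    have e : u i - m = (a' i - a i) * p := by linarith
    rw [e, Int.mul_ediv_cancel _ hp0]
  · rw [if_neg hii]
    have hi := hcoef i
    simp only [Function.update_of_ne hii, hk1, one_mul] at hi
    exact hi

end Literature.Algebra.EuclideanLattices
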